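import Summits.AnomalousDissipation.AnomalousDissipation.Theorems.MarginalStabilityChainStrainedLayerLawClockLine
import Literature.Analysis.FluidPDE.StretchedLayerSliceCalculus

/-!
# Stub `stub_levelSetNull` of line `FirstLemmasR2K4` (log-enstrophy clock; crux `MarginalStabilityChain.StrainedLayerLaw`,
# stmt-AnomalousDissipation-3007) — PROVED

Support file (`--supports stmt-AnomalousDissipation-3007`). We prove the registered stub `stub_levelSetNull`:
for every plane function `f : ℝ → ℝ → ℝ` that is `C¹` (uncurried), the part of its zero set on which the gradient
does not vanish,
  `{q | f q = 0 ∧ (∂ₓf q ≠ 0 ∨ ∂_yf q ≠ 0)}`,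
is Lebesgue-null in `ℝ × ℝ`. (In the clock line this is the only obstruction to the continuity of the negative
palinstrophy `t ↦ P₋(t) = ∫∫ 1_{ω<0} |∇ω|²` along a solution.) Route, all folklore:

* one variable: for ANY `g : ℝ → ℝ` the set `{y | g y = 0 ∧ g′ y ≠ 0}` is relatively discrete — at such a point `g`
  is differentiable with nonzero derivative, so `g ≠ 0` on a punctured neighbourhood (`HasDerivAt.eventually_ne`) —
  hence countable (`ℝ` is hereditarily Lindelöf, `IsLindelof.countable_of_isDiscrete`) and Lebesgue-null;
* two variables: `{f = 0 ∧ ∂_yf ≠ 0}` has countable vertical slices and `{f = 0 ∧ ∂ₓf ≠ 0}` countable horizontal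
  slices (the slice derivatives `dX`, `dY` ARE the derivatives of the slices); both sets are Borel for `C¹ f`
  (`f`, `∂ₓf`, `∂_yf` continuous, `continuous_dX/dY`), so Tonelli (`Measure.prod_apply`, `Measure.prod_apply_symm`)
  gives measure zero, and the stub's set is the union of the two.

References: folklore (the most elementary Sard/implicit-function-type statement);
`Literature/Analysis/FluidPDE/StretchedLayerSliceCalculus.lean`.
-/

-- `Summit.<Summit>.<Problem>` is the tree's mandated summit-side namespace (CONVENTIONS §2); for this
-- single-conjunct summit the two coincide, so the duplicate is deliberate.
set_option linter.dupNamespace false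

noncomputable section

open scoped Topology ENNReal
open Filter Set Function MeasureTheory

namespace Summit.AnomalousDissipation.AnomalousDissipation.Theorems.StrainedLayerLaw.LogEnstrophyClock

open Literature.Analysis.FluidPDE Literature.Analysis.FluidPDE.StretchedLayer
open Summit.AnomalousDissipation.AnomalousDissipation.Theses.MarginalStabilityChain
open Summit.AnomalousDissipation.AnomalousDissipation.Theorems.StrainedLayerLaw.StrainWorkSumRule

/-! ## One variable: zeros with nonzero derivative are isolated, hence countable, hence null -/

/-- For any real function `g`, the set of zeros of `g` at which `deriv g ≠ 0` is countable: each such zero is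
isolated among the zeros (`HasDerivAt.eventually_ne`), so the set is relatively discrete, and `ℝ` is hereditarily
Lindelöf. [folklore] -/
theorem countable_zero_deriv_ne (g : ℝ → ℝ) : Set.Countable {y : ℝ | g y = 0 ∧ deriv g y ≠ 0} := by
  refine (HereditarilyLindelofSpace.isLindelof _).countable_of_isDiscrete
    (isDiscrete_iff_nhdsNE.2 fun y hy => ?_)
  have hd : HasDerivAt g (deriv g y) y := (differentiableAt_of_deriv_ne_zero hy.2).hasDerivAt
  have hev : ∀ᶠ z in 𝓝[≠] y, g z ≠ 0 := hd.eventually_ne hy.2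
  rw [inf_principal_eq_bot]
  exact hev.mono fun z hz h => hz h.1

/-- For any real function `g`, the set of zeros of `g` at which `deriv g ≠ 0` is Lebesgue-null. [folklore] -/
theorem volume_zero_deriv_ne (g : ℝ → ℝ) : volume {y : ℝ | g y = 0 ∧ deriv g y ≠ 0} = 0 :=
  (countable_zero_deriv_ne g).measure_zero volume

/-! ## Two variables: Tonelli over countable slices -/

/-- For a `C¹` plane function, `{f = 0 ∧ ∂_yf ≠ 0}` is measurable (closed ∩ open). [folklore] -/
theorem measurableSet_zero_dY_ne {f : ℝ → ℝ → ℝ} (hf : ContDiff ℝ 1 (fun q : ℝ × ℝ => f q.1 q.2)) :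
    MeasurableSet {q : ℝ × ℝ | f q.1 q.2 = 0 ∧ dY f q.1 q.2 ≠ 0} :=
  (isClosed_eq hf.continuous continuous_const).measurableSet.inter
    (isOpen_ne_fun (continuous_dY hf) continuous_const).measurableSet

/-- For a `C¹` plane function, `{f = 0 ∧ ∂ₓf ≠ 0}` is measurable (closed ∩ open). [folklore] -/
theorem measurableSet_zero_dX_ne {f : ℝ → ℝ → ℝ} (hf : ContDiff ℝ 1 (fun q : ℝ × ℝ => f q.1 q.2)) :
    MeasurableSet {q : ℝ × ℝ | f q.1 q.2 = 0 ∧ dX f q.1 q.2 ≠ 0} :=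
  (isClosed_eq hf.continuous continuous_const).measurableSet.inter
    (isOpen_ne_fun (continuous_dX hf) continuous_const).measurableSet

/-- `{f = 0 ∧ ∂_yf ≠ 0}` is Lebesgue-null for a `C¹` plane function `f`: its vertical slices are countable
(`∂_yf(x, ·)` is the derivative of the slice `f(x, ·)`), and Tonelli. [folklore] -/
theorem volume_zero_dY_ne {f : ℝ → ℝ → ℝ} (hf : ContDiff ℝ 1 (fun q : ℝ × ℝ => f q.1 q.2)) :
    volume {q : ℝ × ℝ | f q.1 q.2 = 0 ∧ dY f q.1 q.2 ≠ 0} = 0 := by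
  rw [Measure.volume_eq_prod ℝ ℝ, Measure.prod_apply (measurableSet_zero_dY_ne hf)]
  have h : ∀ x : ℝ, volume (Prod.mk x ⁻¹' {q : ℝ × ℝ | f q.1 q.2 = 0 ∧ dY f q.1 q.2 ≠ 0}) = 0 :=
    fun x => volume_zero_deriv_ne (fun s => f x s)
  simp only [h, lintegral_zero]

/-- `{f = 0 ∧ ∂ₓf ≠ 0}` is Lebesgue-null for a `C¹` plane function `f`: its horizontal slices are countable
(`∂ₓf(·, y)` is the derivative of the slice `f(·, y)`), and Tonelli in the swapped order. [folklore] -/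
theorem volume_zero_dX_ne {f : ℝ → ℝ → ℝ} (hf : ContDiff ℝ 1 (fun q : ℝ × ℝ => f q.1 q.2)) :
    volume {q : ℝ × ℝ | f q.1 q.2 = 0 ∧ dX f q.1 q.2 ≠ 0} = 0 := by
  rw [Measure.volume_eq_prod ℝ ℝ, Measure.prod_apply_symm (measurableSet_zero_dX_ne hf)]
  have h : ∀ y : ℝ, volume ((fun x : ℝ => (x, y)) ⁻¹' {q : ℝ × ℝ | f q.1 q.2 = 0 ∧ dX f q.1 q.2 ≠ 0}) = 0 :=
    fun y => volume_zero_deriv_ne (fun s => f s y)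
  simp only [h, lintegral_zero]

/-! ## The stub -/

/-- **Stub `stub_levelSetNull` (line `FirstLemmasR2K4`).** For every `C¹` plane function `f`, the part of the
zero set `{f = 0}` on which the gradient `(∂ₓf, ∂_yf)` does not vanish is Lebesgue-null in `ℝ × ℝ`: it is the
union of `{f = 0 ∧ ∂ₓf ≠ 0}` and `{f = 0 ∧ ∂_yf ≠ 0}`, each null by countable slices and Tonelli
(`volume_zero_dX_ne`, `volume_zero_dY_ne`). [folklore] -/
theorem stub_levelSetNull : ∀ (f : ℝ → ℝ → ℝ), ContDiff ℝ 1 (fun q : ℝ × ℝ => f q.1 q.2) →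
    volume {q : ℝ × ℝ | f q.1 q.2 = 0 ∧ (dX f q.1 q.2 ≠ 0 ∨ dY f q.1 q.2 ≠ 0)} = 0 := by
  intro f hf
  refine measure_mono_null (fun q hq => ?_)
    (measure_union_null (volume_zero_dX_ne hf) (volume_zero_dY_ne hf))
  rcases hq with ⟨h0, h1 | h1⟩
  · exact Or.inl ⟨h0, h1⟩
  · exact Or.inr ⟨h0, h1⟩

end Summit.AnomalousDissipation.AnomalousDissipation.Theorems.StrainedLayerLaw.LogEnstrophyClock

end
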